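import Summits.ValiantsHypothesis.ValiantsHypothesis.Theorems.BarrierLeverPartitionMinorsChowSizeFiveKernel

/-!
# Route BarrierLever — Chow witnesses for partition minors (item 20172, CPM): the `(h = 4, r = 5)`
# core — BRIDGE from layouts `Fin 5 → Finset (Fin 4)` to the list-coded kernel checks

Helper file (`--supports stmt-ValiantsHypothesis-20172`; cell valiant-natproofs, rung V4, 𝒟-side of
door (c); seat val-np-p4 gen 12; step 2 of 3 towards `chowHits_of_size_le_five`).  Closes NO item.

The kernel file `…ChowSizeFiveKernel` classifies and certifies `5`-families of subsets of `Fin 4` as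
increasing LISTS OF CODES.  This file transports those checks to actual layout sides
`f : Fin 5 → Finset (Fin 4)`:

* codes: `testBit_code4`, `code4_injective`, `decode4` / `code4_decode4`; the `24` coordinate
  permutations as equivalences `perm4 g` and **`code4_map_perm4`** — the table `permCodeTab` of the
  kernel file IS their action on codes (`code4 (T.map (perm4 g)) = pc g (code4 T)`, kernel check);
  `pc_inv` (inverse permutations on codes);
* `exists_perm_of_range_eq` — two `Fin n`-indexed families with the same range, one injective,
  differ by a permutation of the indices;
* **`exists_sortedCodes`** — an injective `5`-family has, after a permutation of its indices,
  strictly increasing codes `t 0 < ⋯ < t 4 < 16` (via `Finset.orderEmbOfFin`), so `allSorted5_spec`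
  applies; `mem_sortedCodes` / `degL_sortedCodes` / `avoidsL_sortedCodes` transfer membership and
  the literal-class sizes `#{i : a ∈ f i}` to the list side;
* readers of the kernel checks: `exists_of_coverMask` (a set bit of `coverMask` names a normal form
  and a permutation row), `exists_centre`, `detL_ne_zero_of_mem`, `rep95L_getD_lt`, and small
  bookkeeping (`mem_starList`, `mem_iff_getD_of_length`, …).

WHAT THIS IS NOT: bookkeeping between two encodings; nothing on items 20172 / 20195 / 19717
themselves, on crux stmt-ValiantsHypothesis-14610, or on `VP` versus `VNP`.
-/

set_option linter.dupNamespace false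

namespace Summit.ValiantsHypothesis.ValiantsHypothesis.Theorems.BarrierLever.ChowFactor

open Finset

/-! ## B1. Codes of subsets of `Fin 4` -/

/-- Bit `a` of the code of `T` records membership of `a` in `T`. -/
theorem testBit_code4 : ∀ (T : Finset (Fin 4)) (a : Fin 4), (code4 T : ℕ).testBit a = decide (a ∈ T) := by
  decide +kernel

/-- `code4` is injective. -/
theorem code4_injective : Function.Injective code4 := by
  have h : ∀ S T : Finset (Fin 4), code4 S = code4 T → S = T := by decide +kernel
  exact fun S T e => h S T e

/-- The subset of `Fin 4` with a given code (bits `0 … 3`). -/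
def decode4 (s : ℕ) : Finset (Fin 4) := Finset.univ.filter fun a : Fin 4 => s.testBit a

/-- `code4` inverts `decode4` on codes `< 16`. -/
theorem code4_decode4 : ∀ s : Fin 16, (code4 (decode4 s) : ℕ) = s := by
  decide +kernel

/-! ## B2. The `24` coordinate permutations as equivalences, and their action on codes -/

/-- The `24` permutations of `Fin 4` as functions (lexicographic order of `[π 0, π 1, π 2, π 3]`,
the order of the rows of `permCodeTab`). -/
def permFun4 : Fin 24 → Fin 4 → Fin 4 := ![![0, 1, 2, 3], ![0, 1, 3, 2], ![0, 2, 1, 3], ![0, 2, 3, 1],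
  ![0, 3, 1, 2], ![0, 3, 2, 1], ![1, 0, 2, 3], ![1, 0, 3, 2], ![1, 2, 0, 3], ![1, 2, 3, 0], ![1, 3, 0, 2],
  ![1, 3, 2, 0], ![2, 0, 1, 3], ![2, 0, 3, 1], ![2, 1, 0, 3], ![2, 1, 3, 0], ![2, 3, 0, 1], ![2, 3, 1, 0],
  ![3, 0, 1, 2], ![3, 0, 2, 1], ![3, 1, 0, 2], ![3, 1, 2, 0], ![3, 2, 0, 1], ![3, 2, 1, 0]]

/-- Number of the inverse permutation. -/
def permInv4 : Fin 24 → Fin 24 :=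
  ![0, 1, 2, 4, 3, 5, 6, 7, 12, 18, 13, 19, 8, 10, 14, 20, 16, 22, 9, 11, 15, 21, 17, 23]

/-- `permFun4 (permInv4 g)` is a two-sided inverse of `permFun4 g`. -/
theorem permFun4_inv : ∀ (g : Fin 24) (a : Fin 4),
    permFun4 (permInv4 g) (permFun4 g a) = a ∧ permFun4 g (permFun4 (permInv4 g) a) = a := by
  decide

/-- The `24` coordinate permutations of `Fin 4` as equivalences. -/
def perm4 (g : Fin 24) : Equiv.Perm (Fin 4) :=
  ⟨permFun4 g, permFun4 (permInv4 g), fun a => (permFun4_inv g a).1, fun a => (permFun4_inv g a).2⟩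

/-- **The table `permCodeTab` IS the action on codes**: the code of `T.map (perm4 g)` is `pc g (code4 T)`. -/
theorem code4_map_perm4 : ∀ (g : Fin 24) (T : Finset (Fin 4)),
    (code4 (T.map (perm4 g).toEmbedding) : ℕ) = pc g (code4 T) := by
  decide +kernel

/-! ## B3. Small facts about the kernel data -/

/-- Entries of the normal forms are codes `< 16`. -/
theorem rep95L_lt : (rep95L.all fun rep => rep.all fun s => decide (s < 16)) = true := by decide

/-- Membership in a star list is being a value of `starCode`. -/
theorem mem_starList (b x : ℕ) : x ∈ starList b ↔ ∃ j : Fin 5, starCode b j = x := by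
  simp only [starList, starCode, List.mem_cons, List.mem_nil_iff, or_false, Fin.exists_fin_succ]
  simp only [Matrix.cons_val_zero, Matrix.cons_val_succ, Matrix.cons_val_fin_one]
  tauto

/-- The star codes of the canonical centres are codes `< 16`. -/
theorem starCode_canon_lt : ∀ c ∈ [0, 1, 3, 7, 15], ∀ j : Fin 5, starCode c j < 16 := by decide

/-- Members of a star list of a centre `< 16` are codes `< 16`. -/
theorem starList_lt : ∀ b ∈ List.range 16, ∀ x ∈ starList b, x < 16 := by decide

/-- `pc (permInv4 g)` undoes `pc g` on codes `< 16`, and conversely. -/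
theorem pc_inv : ∀ (g : Fin 24) (y : Fin 16),
    pc (permInv4 g) (pc g y) = y ∧ pc g (pc (permInv4 g) y) = y := by decide +kernel

/-- A list with five entries: membership is being one of the five `getD` values. -/
theorem mem_iff_getD_of_length {l : List ℕ} (hl : l.length = 5) (x : ℕ) :
    x ∈ l ↔ ∃ i : Fin 5, l.getD i 0 = x := by
  constructor
  · intro hx
    obtain ⟨k, hk, e⟩ := List.getElem_of_mem hx
    refine ⟨⟨k, lt_of_lt_of_eq hk hl⟩, ?_⟩
    rw [List.getD_eq_getElem?_getD, List.getElem?_eq_getElem hk, Option.getD_some, e]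
  · rintro ⟨i, rfl⟩
    have hi : (i : ℕ) < l.length := by rw [hl]; exact i.2
    rw [List.getD_eq_getElem?_getD, List.getElem?_eq_getElem hi, Option.getD_some]
    exact List.getElem_mem hi

/-! ## B4. Ranges and permutations -/

/-- **Equal ranges differ by a permutation of the index set**: if `f` is injective and `g` has the same
range, then `f ∘ σ = g` for some permutation `σ` (so `g` is injective too). -/
theorem exists_perm_of_range_eq {n : ℕ} {α : Type*} [DecidableEq α] (f g : Fin n → α)
    (hf : Function.Injective f) (hfg : ∀ x, (∃ i, f i = x) ↔ ∃ j, g j = x) :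
    ∃ σ : Equiv.Perm (Fin n), ∀ j, f (σ j) = g j := by
  classical
  have hsur : ∀ j, ∃ i, f i = g j := fun j => (hfg (g j)).mpr ⟨j, rfl⟩
  choose s hs using hsur
  -- `g` is injective: its image has `n` elements
  have himg : Finset.univ.image g = Finset.univ.image f := by
    ext x
    simp only [Finset.mem_image, Finset.mem_univ, true_and]
    exact (hfg x).symm
  have hg : Function.Injective g := by
    have hc : (Finset.univ.image g).card = (Finset.univ : Finset (Fin n)).card := by
      rw [himg, Finset.card_image_of_injective _ hf]
    have := Finset.card_image_iff.mp hc
    intro i j hij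
    exact this (Finset.mem_coe.mpr (Finset.mem_univ i)) (Finset.mem_coe.mpr (Finset.mem_univ j)) hij
  have hsinj : Function.Injective s := fun j j' hjj => hg (by rw [← hs j, ← hs j', hjj])
  exact ⟨Equiv.ofBijective s (Finite.injective_iff_bijective.mp hsinj), fun j => hs j⟩

/-! ## B5. The sorted code tuple of an injective `5`-family -/

/-- **Sorted codes**: an injective `5`-family of subsets of `Fin 4` has, after a permutation `σ` of
its indices, strictly increasing codes `t 0 < ⋯ < t 4 < 16`. -/
theorem exists_sortedCodes (f : Fin 5 → Finset (Fin 4)) (hf : Function.Injective f) :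
    ∃ (t : Fin 5 → ℕ) (σ : Equiv.Perm (Fin 5)), StrictMono t ∧ (∀ i, t i < 16) ∧
      ∀ i, (code4 (f (σ i)) : ℕ) = t i := by
  classical
  set S : Finset (Fin 16) := Finset.univ.image fun i => code4 (f i) with hS
  have hcard : S.card = 5 := by
    rw [hS, Finset.card_image_of_injective _
      (show Function.Injective (fun i => code4 (f i)) from code4_injective.comp hf),
      Finset.card_univ, Fintype.card_fin]
  obtain ⟨σ, hσ⟩ := exists_perm_of_range_eq (fun i => code4 (f i)) (fun i => S.orderEmbOfFin hcard i)
    (code4_injective.comp hf) (fun x => by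
      constructor
      · rintro ⟨i, rfl⟩
        have hx : code4 (f i) ∈ S := Finset.mem_image.mpr ⟨i, Finset.mem_univ _, rfl⟩
        rw [← Finset.image_orderEmbOfFin_univ S hcard] at hx
        obtain ⟨j, -, hj⟩ := Finset.mem_image.mp hx
        exact ⟨j, hj⟩
      · rintro ⟨j, rfl⟩
        have hx : S.orderEmbOfFin hcard j ∈ Finset.univ.image (fun i => code4 (f i)) :=
          Finset.orderEmbOfFin_mem S hcard j
        obtain ⟨i, -, hi⟩ := Finset.mem_image.mp hx
        exact ⟨i, hi⟩)
  refine ⟨fun i => (S.orderEmbOfFin hcard i : ℕ), σ, fun i j hij => ?_, fun i => (S.orderEmbOfFin hcard i).2,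
    fun i => by rw [hσ i]⟩
  exact Fin.lt_def.mp ((S.orderEmbOfFin hcard).strictMono hij)

/-- Membership transfer: the sorted codes are exactly the codes of the family. -/
theorem mem_sortedCodes (f : Fin 5 → Finset (Fin 4)) (t : Fin 5 → ℕ) (σ : Equiv.Perm (Fin 5))
    (ht : ∀ i, (code4 (f (σ i)) : ℕ) = t i) (x : ℕ) :
    x ∈ [t 0, t 1, t 2, t 3, t 4] ↔ ∃ i, (code4 (f i) : ℕ) = x := by
  have e : [t 0, t 1, t 2, t 3, t 4] = List.ofFn t := rfl
  rw [e, List.mem_ofFn']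
  constructor
  · rintro ⟨i, rfl⟩
    exact ⟨σ i, ht i⟩
  · rintro ⟨i, rfl⟩
    exact ⟨σ.symm i, by rw [← ht, Equiv.apply_symm_apply]⟩

/-- Degree transfer: the list degree of the sorted codes at `a` is the size of the literal class
`{i : a ∈ f i}`. -/
theorem degL_sortedCodes (f : Fin 5 → Finset (Fin 4)) (t : Fin 5 → ℕ) (σ : Equiv.Perm (Fin 5))
    (ht : ∀ i, (code4 (f (σ i)) : ℕ) = t i) (a : Fin 4) :
    degL [t 0, t 1, t 2, t 3, t 4] a = (Finset.univ.filter fun i => a ∈ f i).card := by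
  classical
  have hb : ∀ i, (t i).testBit a = decide (a ∈ f (σ i)) := fun i => by rw [← ht i, testBit_code4]
  have hσ : (Finset.univ.filter fun i => a ∈ f i).card =
      (Finset.univ.filter fun i => a ∈ f (σ i)).card := by
    rw [show (Finset.univ.filter fun i => a ∈ f (σ i)) =
        (Finset.univ.filter fun i => a ∈ f i).map σ.symm.toEmbedding from ?_, Finset.card_map]
    ext i
    simp [Finset.mem_map_equiv]
  rw [hσ, Finset.card_filter, Fin.sum_univ_five]
  simp only [degL, List.countP_cons, List.countP_nil, hb, decide_eq_true_eq]
  ring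

/-- `avoidsL` transfer: the family has no literal class of size `d₁` or `d₂`. -/
theorem avoidsL_sortedCodes (f : Fin 5 → Finset (Fin 4)) (t : Fin 5 → ℕ) (σ : Equiv.Perm (Fin 5))
    (ht : ∀ i, (code4 (f (σ i)) : ℕ) = t i) (d₁ d₂ : ℕ)
    (hf : ∀ a : Fin 4, (Finset.univ.filter fun i => a ∈ f i).card ≠ d₁ ∧
      (Finset.univ.filter fun i => a ∈ f i).card ≠ d₂) :
    avoidsL [t 0, t 1, t 2, t 3, t 4] d₁ d₂ = true := by
  simp only [avoidsL, List.all_eq_true, List.mem_range, Bool.and_eq_true, bne_iff_ne, ne_eq]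
  intro a ha
  rw [show a = ((⟨a, ha⟩ : Fin 4) : ℕ) from rfl, degL_sortedCodes f t σ ht ⟨a, ha⟩]
  exact hf ⟨a, ha⟩

/-! ## B6. Reading the kernel checks -/

/-- Bits of an iterated `2 ^ m b ||| ·` come from the list or from the seed. -/
theorem testBit_foldr_pow_or {β : Type*} (l : List β) (m : β → ℕ) (init x : ℕ)
    (h : (l.foldr (fun b acc => 2 ^ m b ||| acc) init).testBit x = true) :
    (∃ b ∈ l, m b = x) ∨ init.testBit x = true := by
  induction l with
  | nil => exact Or.inr h
  | cons b l ih =>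
    rw [List.foldr_cons, Nat.testBit_or, Bool.or_eq_true, Nat.testBit_two_pow] at h
    rcases h with h | h
    · exact Or.inl ⟨b, List.mem_cons_self, of_decide_eq_true h⟩
    · rcases ih h with ⟨b', hb', e⟩ | h'
      · exact Or.inl ⟨b', List.mem_cons_of_mem _ hb', e⟩
      · exact Or.inr h'

/-- **Reading `coverMask`**: a set bit names a normal form and a permutation row. -/
theorem exists_of_coverMask {x : ℕ} (h : coverMask.testBit x = true) :
    ∃ rep ∈ rep95L, ∃ row ∈ permCodeTab, maskL (rep.map fun s => row.getD s 0) = x := by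
  unfold coverMask at h
  suffices key : ∀ (L : List (List ℕ)) (init : ℕ),
      ((L.foldr (fun rep acc => permCodeTab.foldr
        (fun row acc' => 2 ^ maskL (rep.map fun s => row.getD s 0) ||| acc') acc) init).testBit x = true) →
      (∃ rep ∈ L, ∃ row ∈ permCodeTab, maskL (rep.map fun s => row.getD s 0) = x) ∨ init.testBit x = true by
    rcases key rep95L 0 h with h' | h'
    · exact h'
    · simp at h'
  intro L init hL
  induction L with
  | nil => exact Or.inr hL
  | cons rep L ih =>
    rw [List.foldr_cons] at hL
    rcases testBit_foldr_pow_or permCodeTab (fun row => maskL (rep.map fun s => row.getD s 0)) _ x hL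
      with ⟨row, hrow, e⟩ | h'
    · exact Or.inl ⟨rep, List.mem_cons_self, row, hrow, e⟩
    · rcases ih h' with ⟨rep', hrep', row, hrow, e⟩ | h''
      · exact Or.inl ⟨rep', List.mem_cons_of_mem _ hrep', row, hrow, e⟩
      · exact Or.inr h''

/-- A row of `permCodeTab` is `permCodeTab.getD g []` for some `g : Fin 24`. -/
theorem exists_fin24_of_mem_permCodeTab {row : List ℕ} (h : row ∈ permCodeTab) :
    ∃ g : Fin 24, permCodeTab.getD g [] = row := by
  obtain ⟨k, hk, e⟩ := List.getElem_of_mem h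
  refine ⟨⟨k, by simpa [permCodeTab] using hk⟩, ?_⟩
  rw [List.getD_eq_getElem?_getD, List.getElem?_eq_getElem hk, Option.getD_some, e]

/-- Equal masks: equal members. -/
theorem mem_iff_of_maskL_eq {l l' : List ℕ} (h : maskL l = maskL l') (x : ℕ) : x ∈ l ↔ x ∈ l' := by
  rw [← testBit_maskL, h, testBit_maskL]

/-- **Reading `centre_kernel`**: every star of a centre `b < 16` is carried by some coordinate
permutation onto the star of a canonical centre, as code sets. -/
theorem exists_centre (b : ℕ) (hb : b < 16) : ∃ (g : Fin 24) (c : ℕ), c ∈ [0, 1, 3, 7, 15] ∧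
    ∀ x, (∃ y ∈ starList b, pc g y = x) ↔ x ∈ starList c := by
  have h := List.all_eq_true.mp centre_kernel b (List.mem_range.mpr hb)
  obtain ⟨g, hg, h⟩ := List.any_eq_true.mp h
  obtain ⟨c, hc, h⟩ := List.any_eq_true.mp h
  refine ⟨⟨g, List.mem_range.mp hg⟩, c, hc, fun x => ?_⟩
  rw [← mem_iff_of_maskL_eq (beq_iff_eq.mp h) x, List.mem_map]

/-- **Reading `rep95_certified`**. -/
theorem detL_ne_zero_of_mem {rep : List ℕ} (hrep : rep ∈ rep95L) {c : ℕ} (hc : c ∈ [0, 1, 3, 7, 15]) :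
    detL 5 (fun i j => t6R (rep.getD i 0) (starCode c j)) ≠ 0 := by
  have h := List.all_eq_true.mp (List.all_eq_true.mp rep95_certified rep hrep) c hc
  simpa using h

/-- **Reading `rep95L_length` / `rep95L_lt`**. -/
theorem rep95L_getD_lt {rep : List ℕ} (hrep : rep ∈ rep95L) : rep.length = 5 ∧ ∀ i : Fin 5, rep.getD i 0 < 16 := by
  have hl : rep.length = 5 := by
    simpa using List.all_eq_true.mp rep95L_length rep hrep
  refine ⟨hl, fun i => ?_⟩
  have h := List.all_eq_true.mp (List.all_eq_true.mp rep95L_lt rep hrep) (rep.getD i 0)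
    ((mem_iff_getD_of_length hl _).mpr ⟨i, rfl⟩)
  simpa using h


end Summit.ValiantsHypothesis.ValiantsHypothesis.Theorems.BarrierLever.ChowFactor
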